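import Mathlib.Analysis.SpecialFunctions.Integrals.Basic
import Mathlib.MeasureTheory.Integral.DominatedConvergence
import Mathlib.Analysis.Convex.SpecificFunctions.Basic
import Mathlib.Analysis.Convex.Jensen
import Mathlib.Analysis.Complex.RealDeriv
import Mathlib.Analysis.SpecialFunctions.Log.Basic
import Literature.MathematicalPhysics.QuantumLattice.FinDimSpectrumProofs
import HarnessLib

/-!
# The Duhamel two-point function of a quantum Gibbs state and the Falk–Bruch inequality

Trunk T-QLATTICE (matrix analysis behind the quantum-lattice statements; consumer: the
positive-temperature infrared bound of the hard-core lattice gas,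
`Literature/Barriers/AtomisticToContinuum/HalfFillingThermalKLS.lean`, fact (Aᵀ)).

For a Hamiltonian `H : Matrix n n ℂ` and inverse temperature `β` this file provides, next to the
Gibbs state `Matrix.gibbsState β H` of `FinDimSpectrum.lean`,

* the **Duhamel two-point function** `Matrix.duhamel β H A B = Z⁻¹ ∫₀¹ tr(A e^{-sβH} B e^{-(1-s)βH}) ds`
  ([LSSY2005] (11.9); [DLS1978] (5));
* its **spectral representations** in an eigenbasis of `H` (pair sums over eigenvalues), together
  with those of `⟨A²⟩` and of the double commutator `⟨[A,[H,A]]⟩` ([DLS1978] (35));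
* the **Falk–Bruch / Dyson–Lieb–Simon transfer** in the weakened form the infrared-bound
  arguments consume (`Matrix.falkBruch_sum_le`): for Hermitian `A₁,…,A_m`, with `g = Σ⟨A_k²⟩`,
  `b = Σ(A_k,A_k)`, `c = Σ⟨[A_k,[H,A_k]]⟩ ≥ 0` one has `g ≤ b + ½√(β b c)`, hence
  `g ≤ b₀ + ½√(β b₀ c)` whenever `b ≤ b₀` — this is [DLS1978] Thm. 3.1 (`b ≥ g f(c/4g)`),
  Cor. 3.2 and Thm. 3.2 (`g ≤ ½√(c₀b₀) coth √(c₀/4b₀)`) combined with `coth x ≤ 1 + 1/x`, as used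
  in [LSSY2005] (11.22)–(11.23); the proof is the per-pair inequality `min(a,b) ≤ L(a,b)` for the
  logarithmic mean and Cauchy–Schwarz;
* the **Peierls–Bogoliubov inequality** `Z(H + W) ≥ Z(H) e^{-β⟨W⟩_H}` (convexity; used for Kubo's
  inequality at positive temperature) and the energy–entropy bound `⟨H⟩_β ≤ E₀(H) + log(dim)/β`;
* the named fact `Matrix.gaussianDomination_duhamel_le` — [DLS1978] eq. (44): Gaussian
  domination `Z(H - tV + ½t²Q) ≤ Z(H) ∀t` implies the Duhamel bound `(V,V) ≤ Q/β` — discharged in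
  the sibling `DuhamelTwoPointProofs.lean` (second-order expansion of `t ↦ tr e^{-β(H-tV)}`).

## References

* [DLS1978] F. J. Dyson, E. H. Lieb, B. Simon, *Phase transitions in quantum spin systems with
  isotropic and nonisotropic interactions*, J. Stat. Phys. 18 (1978) 335–383, §3 (eqs. (5),
  (30)–(40), Thms. 3.1–3.2, Cor. 3.2) and §4 (eq. (44)).
* [LSSY2005] E. H. Lieb, R. Seiringer, J. P. Solovej, J. Yngvason, *The Mathematics of the Bose
  Gas and its Condensation* (2005), Ch. 11, (11.9), (11.22)–(11.23).
* H. Falk, L. W. Bruch, Phys. Rev. 180 (1969) 442 (the inequality of [DLS1978] Thm. 3.1).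

## Design notes

* Everything is over `ℂ`, `[Fintype n] [DecidableEq n]`, in Mathlib's `Matrix` namespace as
  dot-notation extensions (like `Matrix.gibbsState`); `NormedSpace.exp` and the `L2Operator`
  norm scope as in `FinDimSpectrum.lean`.
* Spectral representations are phrased with `hH.eigenvectorUnitary`, `hH.eigenvalues` and the
  rotated observable `A' = U⋆ A U`; the Duhamel kernel is kept as the integral
  `K(x,y) = ∫₀¹ e^{-β(sy + (1-s)x)} ds` (the logarithmic mean of `e^{-βx}`, `e^{-βy}`), whose two
  properties used are `min ≤ K` and `e^{-βx} - e^{-βy} = β(y-x)K(x,y)`.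
-/

noncomputable section

open scoped Matrix.Norms.L2Operator ComplexOrder
open Finset MeasureTheory intervalIntegral

namespace Matrix

variable {n : Type*} [Fintype n] [DecidableEq n]

/-! ### The Duhamel two-point function -/

/-- (Dot-notation extension of Mathlib's `Matrix`.) The **Duhamel two-point function**
`(A, B) = Z⁻¹ ∫₀¹ tr(A e^{-sβH} B e^{-(1-s)βH}) ds` of the Gibbs state at inverse temperature `β`
(junk `0` when `Z = 0`). [cite: LSSY2005, Ch. 11 (11.9)] [cite: DLS1978, eq. (5)] -/
def duhamel (β : ℝ) (H A B : Matrix n n ℂ) : ℂ :=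
  (partitionFn β H)⁻¹ *
    ∫ s in (0 : ℝ)..1, (A * gibbsWeight (s * β) H * B * gibbsWeight ((1 - s) * β) H).trace

/-- The Duhamel kernel `K_β(x, y) = ∫₀¹ e^{-β(s y + (1-s) x)} ds` (the logarithmic mean of
`e^{-βx}` and `e^{-βy}`). [cite: DLS1978, eq. (35)] -/
def duhamelKernel (β x y : ℝ) : ℝ :=
  ∫ s in (0 : ℝ)..1, Real.exp (-(β * (s * y + (1 - s) * x)))

/-! ### The Duhamel kernel: positivity, `min ≤ K`, and `e^{-βx} - e^{-βy} = β (y - x) K` -/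

/-- The integrand of the Duhamel kernel is continuous. [folklore] -/
theorem continuous_duhamelKernel_integrand (β x y : ℝ) :
    Continuous fun s : ℝ => Real.exp (-(β * (s * y + (1 - s) * x))) := by
  fun_prop

/-- `min(e^{-βx}, e^{-βy}) ≤ K_β(x,y)`: the exponent is a convex combination. [folklore] -/
theorem min_exp_le_duhamelKernel (β x y : ℝ) :
    min (Real.exp (-(β * x))) (Real.exp (-(β * y))) ≤ duhamelKernel β x y := by
  have hconst : ∫ _ in (0 : ℝ)..1, min (Real.exp (-(β * x))) (Real.exp (-(β * y))) =
      min (Real.exp (-(β * x))) (Real.exp (-(β * y))) := by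
    simp
  rw [duhamelKernel, ← hconst]
  refine intervalIntegral.integral_mono_on zero_le_one (by simp)
    ((continuous_duhamelKernel_integrand β x y).intervalIntegrable _ _) fun s hs => ?_
  obtain ⟨hs0, hs1⟩ := hs
  -- `β(sy + (1-s)x)` lies between `βx` and `βy`
  have key : -(β * (s * y + (1 - s) * x)) = s * (-(β * y)) + (1 - s) * (-(β * x)) := by ring
  rw [key]
  rcases le_total (-(β * x)) (-(β * y)) with hxy | hxy
  · calc min (Real.exp (-(β * x))) (Real.exp (-(β * y))) ≤ Real.exp (-(β * x)) := min_le_left _ _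
      _ ≤ Real.exp (s * -(β * y) + (1 - s) * -(β * x)) :=
          Real.exp_le_exp.2 (by nlinarith)
  · calc min (Real.exp (-(β * x))) (Real.exp (-(β * y))) ≤ Real.exp (-(β * y)) := min_le_right _ _
      _ ≤ Real.exp (s * -(β * y) + (1 - s) * -(β * x)) :=
          Real.exp_le_exp.2 (by nlinarith)

/-- `K > 0`. [folklore] -/
theorem duhamelKernel_pos (β x y : ℝ) : 0 < duhamelKernel β x y :=
  lt_of_lt_of_le (lt_min (Real.exp_pos _) (Real.exp_pos _)) (min_exp_le_duhamelKernel β x y)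

/-- **The logarithmic-mean identity** `e^{-βx} - e^{-βy} = β (y - x) K_β(x,y)` (fundamental theorem
of calculus for `s ↦ e^{-β(sy + (1-s)x)}`). [folklore] -/
theorem exp_sub_exp_eq_mul_duhamelKernel (β x y : ℝ) :
    Real.exp (-(β * x)) - Real.exp (-(β * y)) = β * (y - x) * duhamelKernel β x y := by
  set f : ℝ → ℝ := fun s => Real.exp (-(β * (s * y + (1 - s) * x))) with hf
  have hderiv : ∀ s ∈ Set.uIcc (0 : ℝ) 1,
      HasDerivAt f (-(β * (y - x)) * f s) s := by
    intro s _
    have h1 : HasDerivAt (fun s : ℝ => -(β * (s * y + (1 - s) * x))) (-(β * (y - x))) s := by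
      have := ((((hasDerivAt_id s).mul_const y).add
        (((hasDerivAt_const s (1 : ℝ)).sub (hasDerivAt_id s)).mul_const x)).const_mul β).neg
      refine this.congr_deriv ?_
      ring
    refine (h1.exp).congr_deriv ?_
    ring
  have hint : IntervalIntegrable (fun s => -(β * (y - x)) * f s) volume 0 1 :=
    ((continuous_duhamelKernel_integrand β x y).const_mul _).intervalIntegrable _ _
  have hFTC := intervalIntegral.integral_eq_sub_of_hasDerivAt hderiv hint
  rw [intervalIntegral.integral_const_mul] at hFTC
  have h0 : f 0 = Real.exp (-(β * x)) := by simp [hf]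
  have h1 : f 1 = Real.exp (-(β * y)) := by simp [hf]
  rw [h0, h1] at hFTC
  rw [duhamelKernel]
  linarith

/-- **The per-pair Falk–Bruch inequality** (the content of [DLS1978] Thm. 3.1 for a two-level
system, weakened by `coth x ≤ 1 + 1/x`): with `a = e^{-βx}`, `b = e^{-βy}`, `K = K_β(x,y)`,
`½(a + b) ≤ K + ½|a - b|` (since `½(a+b) = min(a,b) + ½|a-b|` and `min ≤ K`).
[cite: DLS1978, Thm. 3.1] -/
theorem half_add_exp_le_duhamelKernel (β x y : ℝ) :
    (Real.exp (-(β * x)) + Real.exp (-(β * y))) / 2 ≤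
      duhamelKernel β x y + |Real.exp (-(β * x)) - Real.exp (-(β * y))| / 2 := by
  have h := min_exp_le_duhamelKernel β x y
  rcases le_total (Real.exp (-(β * x))) (Real.exp (-(β * y))) with hle | hle
  · rw [min_eq_left hle] at h
    rw [abs_of_nonpos (sub_nonpos.2 hle)]
    linarith
  · rw [min_eq_right hle] at h
    rw [abs_of_nonneg (sub_nonneg.2 hle)]
    linarith

/-- `(a - b)² = β K · [(y - x)(a - b)]` for `a = e^{-βx}`, `b = e^{-βy}`: the product of the Duhamel
and double-commutator pair weights is the square of the difference of Boltzmann weights.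
[cite: DLS1978, eq. (35)] -/
theorem sq_exp_sub_exp_eq (β x y : ℝ) :
    (Real.exp (-(β * x)) - Real.exp (-(β * y))) ^ 2 =
      β * duhamelKernel β x y * ((y - x) * (Real.exp (-(β * x)) - Real.exp (-(β * y)))) := by
  have h := exp_sub_exp_eq_mul_duhamelKernel β x y
  calc (Real.exp (-(β * x)) - Real.exp (-(β * y))) ^ 2
      = (β * (y - x) * duhamelKernel β x y) * (Real.exp (-(β * x)) - Real.exp (-(β * y))) := by
        rw [sq, ← h]
    _ = _ := by ring

/-- The double-commutator pair weight is nonnegative for `β ≥ 0`: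
`(y - x)(e^{-βx} - e^{-βy}) ≥ 0`. [cite: DLS1978, Thm. 3.1 (positivity of `c`)] -/
theorem sub_mul_exp_sub_exp_nonneg {β : ℝ} (hβ : 0 ≤ β) (x y : ℝ) :
    0 ≤ (y - x) * (Real.exp (-(β * x)) - Real.exp (-(β * y))) := by
  rw [exp_sub_exp_eq_mul_duhamelKernel]
  have hK := duhamelKernel_pos β x y
  have : 0 ≤ (y - x) * (y - x) := mul_self_nonneg _
  nlinarith [mul_nonneg (mul_nonneg hβ this) hK.le]

/-! ### Spectral representations in an eigenbasis of `H` -/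

omit [DecidableEq n] in
/-- `tr(X diag(u) Y diag(v)) = Σᵢⱼ Xᵢⱼ uⱼ Yⱼᵢ vᵢ`. [folklore] -/
theorem trace_mul_diagonal_mul_mul_diagonal [DecidableEq n] (X Y : Matrix n n ℂ)
    (u v : n → ℂ) :
    (X * diagonal u * Y * diagonal v).trace = ∑ i, ∑ j, X i j * u j * Y j i * v i := by
  simp only [trace, diag_apply]
  refine sum_congr rfl fun i _ => ?_
  rw [mul_diagonal, mul_apply, Finset.sum_mul]
  refine sum_congr rfl fun j _ => ?_
  rw [mul_diagonal]

omit [DecidableEq n] in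
/-- `tr(diag(w) X Y) = Σᵢⱼ wᵢ Xᵢⱼ Yⱼᵢ`. [folklore] -/
theorem trace_diagonal_mul_mul [DecidableEq n] (X Y : Matrix n n ℂ) (w : n → ℂ) :
    (diagonal w * X * Y).trace = ∑ i, ∑ j, w i * X i j * Y j i := by
  simp only [trace, diag_apply]
  refine sum_congr rfl fun i _ => ?_
  rw [mul_apply]
  refine sum_congr rfl fun j _ => ?_
  rw [diagonal_mul]

omit [DecidableEq n] in
/-- Cyclicity: `tr(U D U⋆ M) = tr(D (U⋆ M U))`. [folklore] -/
theorem trace_unitary_conj_mul (U D M : Matrix n n ℂ) :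
    (U * D * star U * M).trace = (D * (star U * M * U)).trace := by
  rw [Matrix.mul_assoc, Matrix.mul_assoc, trace_mul_comm, Matrix.mul_assoc, Matrix.mul_assoc]

/-- `U⋆ (A B) U = (U⋆ A U)(U⋆ B U)` for unitary `U`. [folklore] -/
theorem star_unitary_mul_mul_mul {U : Matrix n n ℂ} (hU : U ∈ unitary (Matrix n n ℂ))
    (A B : Matrix n n ℂ) :
    star U * (A * B) * U = star U * A * U * (star U * B * U) := by
  simp only [Matrix.mul_assoc]
  rw [← Matrix.mul_assoc U (star U), Unitary.mul_star_self_of_mem hU, Matrix.one_mul]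

omit [DecidableEq n] in
/-- The rotated observable `A' = U⋆AU` of a Hermitian `A` is Hermitian: `conj A'ᵢⱼ = A'ⱼᵢ`.
[folklore] -/
theorem star_apply_rotate {A U : Matrix n n ℂ} (hA : A.IsHermitian) (i j : n) :
    star ((star U * A * U) i j) = (star U * A * U) j i := by
  have h : (star U * A * U)ᴴ = star U * A * U := by
    rw [conjTranspose_mul, conjTranspose_mul, hA.eq, star_eq_conjTranspose,
      conjTranspose_conjTranspose, Matrix.mul_assoc]
  conv_rhs => rw [← h]
  rw [conjTranspose_apply]

/-- `z · conj z = ‖z‖²` as a real cast. [folklore] -/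
theorem mul_star_eq_normSq_cast (z : ℂ) : z * star z = ((‖z‖ ^ 2 : ℝ) : ℂ) := by
  rw [Complex.star_def, Complex.mul_conj, Complex.normSq_eq_norm_sq]

/-- Diagonal entries of `V diag(u) V⋆`: `Σₖ ‖Vᵢₖ‖² uₖ`. [folklore] -/
theorem conj_diagonal_apply_self (V : Matrix n n ℂ) (u : n → ℝ) (i : n) :
    (V * diagonal (fun k => (u k : ℂ)) * star V) i i = ((∑ k, ‖V i k‖ ^ 2 * u k : ℝ) : ℂ) := by
  rw [mul_apply, Complex.ofReal_sum]
  refine sum_congr rfl fun k _ => ?_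
  rw [mul_diagonal, star_eq_conjTranspose, conjTranspose_apply, mul_right_comm,
    Complex.star_def, Complex.mul_conj, Complex.normSq_eq_norm_sq]
  push_cast; ring

/-- Rows of a unitary matrix have unit norm: `Σₖ ‖Vᵢₖ‖² = 1`. [folklore] -/
theorem sum_norm_sq_row_eq_one {V : Matrix n n ℂ} (hV : V ∈ unitary (Matrix n n ℂ)) (i : n) :
    ∑ k, ‖V i k‖ ^ 2 = 1 := by
  have h := congrArg (fun M : Matrix n n ℂ => M i i) (Unitary.mul_star_self_of_mem hV)
  simp only [mul_apply, one_apply_eq] at h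
  have : ∀ k, V i k * (star V) k i = ((‖V i k‖ ^ 2 : ℝ) : ℂ) := by
    intro k
    rw [star_eq_conjTranspose, conjTranspose_apply, Complex.star_def, Complex.mul_conj,
      Complex.normSq_eq_norm_sq]
  simp only [this] at h
  rw [← Complex.ofReal_sum] at h
  exact_mod_cast h

section Spectral

variable {H : Matrix n n ℂ} (hH : H.IsHermitian)

/-- **The Hermitian functional calculus in the eigenbasis**: `f(H) = U diag(f(Eᵢ)) U⋆` (Mathlib's
`Matrix.IsHermitian.cfc_eq`). [folklore] -/
theorem IsHermitian.cfc_eq_conj_diagonal (f : ℝ → ℝ) :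
    cfc f H = (hH.eigenvectorUnitary : Matrix n n ℂ) *
      diagonal (fun i => (f (hH.eigenvalues i) : ℂ)) * star (hH.eigenvectorUnitary : Matrix n n ℂ) := by
  rw [hH.cfc_eq, IsHermitian.cfc, Unitary.conjStarAlgAut_apply]
  rfl

/-- **`e^{-tH} = U diag(e^{-tEᵢ}) U⋆`** in an eigenbasis of the Hermitian `H`
(`CFC.real_exp_eq_normedSpace_exp`). Bratteli–Robinson II §5.3.1. [folklore] -/
theorem IsHermitian.gibbsWeight_eq (t : ℝ) :
    gibbsWeight t H = (hH.eigenvectorUnitary : Matrix n n ℂ) *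
      diagonal (fun i => (Real.exp (-(t * hH.eigenvalues i)) : ℂ)) *
        star (hH.eigenvectorUnitary : Matrix n n ℂ) := by
  have hsmul : (-(t : ℂ) • H : Matrix n n ℂ) = (-t : ℝ) • H := by
    ext i j
    simp [Matrix.smul_apply, Complex.real_smul]
  have h1 : gibbsWeight t H = cfc (fun x : ℝ => Real.exp ((-t) • x)) H := by
    rw [gibbsWeight, hsmul, cfc_comp_smul (-t) Real.exp H, CFC.real_exp_eq_normedSpace_exp]
  rw [h1, hH.cfc_eq_conj_diagonal]
  simp only [smul_eq_mul, neg_mul]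

/-- `e^{M} = U diag(e^{μᵢ}) U⋆` for Hermitian `M`. [folklore] -/
theorem IsHermitian.exp_eq_conj_diagonal :
    NormedSpace.exp H = (hH.eigenvectorUnitary : Matrix n n ℂ) *
      diagonal (fun i => (Real.exp (hH.eigenvalues i) : ℂ)) *
        star (hH.eigenvectorUnitary : Matrix n n ℂ) := by
  rw [← CFC.real_exp_eq_normedSpace_exp (a := H), hH.cfc_eq_conj_diagonal]

/-- The spectral theorem in the form `H = U diag(Eᵢ) U⋆`. [folklore] -/
theorem IsHermitian.eq_conj_diagonal :
    H = (hH.eigenvectorUnitary : Matrix n n ℂ) * diagonal (fun i => (hH.eigenvalues i : ℂ)) *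
      star (hH.eigenvectorUnitary : Matrix n n ℂ) := by
  conv_lhs => rw [hH.spectral_theorem, Unitary.conjStarAlgAut_apply]
  rfl

/-- `U⋆ H U = diag(Eᵢ)`. [folklore] -/
theorem IsHermitian.star_mul_self_mul_eq_diagonal :
    star (hH.eigenvectorUnitary : Matrix n n ℂ) * H * (hH.eigenvectorUnitary : Matrix n n ℂ) =
      diagonal (fun i => (hH.eigenvalues i : ℂ)) := by
  have hUm : (hH.eigenvectorUnitary : Matrix n n ℂ) ∈ unitary (Matrix n n ℂ) :=
    hH.eigenvectorUnitary.prop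
  conv_lhs => arg 1; arg 2; rw [hH.eq_conj_diagonal]
  simp only [Matrix.mul_assoc, Unitary.star_mul_self_of_mem hUm, Matrix.mul_one]
  rw [← Matrix.mul_assoc, Unitary.star_mul_self_of_mem hUm, Matrix.one_mul]

/-- **Spectral form of `⟨A²⟩`**: `tr(e^{-βH} A²) = Σᵢⱼ ‖A'ᵢⱼ‖² e^{-βEᵢ}` for Hermitian `A`,
`A' = U⋆AU`. [cite: DLS1978, eq. (35)] -/
theorem IsHermitian.trace_gibbsWeight_mul_sq {A : Matrix n n ℂ} (hA : A.IsHermitian) (β : ℝ) :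
    (gibbsWeight β H * (A * A)).trace =
      ∑ i, ∑ j, ((‖(star (hH.eigenvectorUnitary : Matrix n n ℂ) * A *
          (hH.eigenvectorUnitary : Matrix n n ℂ)) i j‖ ^ 2 *
            Real.exp (-(β * hH.eigenvalues i)) : ℝ) : ℂ) := by
  set U := (hH.eigenvectorUnitary : Matrix n n ℂ) with hU
  have hUm : U ∈ unitary (Matrix n n ℂ) := hH.eigenvectorUnitary.prop
  set A' := star U * A * U with hA'
  have hsr : ∀ i j, star (A' i j) = A' j i := fun i j => by
    rw [hA']; exact star_apply_rotate hA i j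
  rw [IsHermitian.gibbsWeight_eq hH β, ← hU, trace_unitary_conj_mul,
    star_unitary_mul_mul_mul hUm, ← hA', ← Matrix.mul_assoc, trace_diagonal_mul_mul]
  refine sum_congr rfl fun i _ => sum_congr rfl fun j _ => ?_
  rw [← hsr i j, mul_assoc, mul_star_eq_normSq_cast]
  push_cast
  ring

/-- **Spectral form of the Duhamel integrand**:
`tr(A e^{-sβH} A e^{-(1-s)βH}) = Σᵢⱼ ‖A'ᵢⱼ‖² e^{-β(sEⱼ + (1-s)Eᵢ)}` for Hermitian `A`.
[cite: DLS1978, eq. (35)] -/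
theorem IsHermitian.trace_duhamel_integrand {A : Matrix n n ℂ} (hA : A.IsHermitian) (β s : ℝ) :
    (A * gibbsWeight (s * β) H * A * gibbsWeight ((1 - s) * β) H).trace =
      ∑ i, ∑ j, ((‖(star (hH.eigenvectorUnitary : Matrix n n ℂ) * A *
          (hH.eigenvectorUnitary : Matrix n n ℂ)) i j‖ ^ 2 *
            Real.exp (-(β * (s * hH.eigenvalues j + (1 - s) * hH.eigenvalues i))) : ℝ) : ℂ) := by
  set U := (hH.eigenvectorUnitary : Matrix n n ℂ) with hU
  set A' := star U * A * U with hA'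
  set D₁ : Matrix n n ℂ := diagonal (fun i => (Real.exp (-(s * β * hH.eigenvalues i)) : ℂ))
    with hD₁
  set D₂ : Matrix n n ℂ := diagonal (fun i => (Real.exp (-((1 - s) * β * hH.eigenvalues i)) : ℂ))
    with hD₂
  have hcyc : (A * (U * D₁ * star U) * A * (U * D₂ * star U)).trace =
      (A' * D₁ * A' * D₂).trace := by
    rw [hA']
    calc (A * (U * D₁ * star U) * A * (U * D₂ * star U)).trace
        = ((A * U * D₁ * star U * A * U * D₂) * star U).trace := by
          simp only [Matrix.mul_assoc]
      _ = (star U * (A * U * D₁ * star U * A * U * D₂)).trace := trace_mul_comm _ _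
      _ = (star U * A * U * D₁ * (star U * A * U) * D₂).trace := by
          simp only [Matrix.mul_assoc]
  have hsr : ∀ i j, star (A' i j) = A' j i := fun i j => by
    rw [hA']; exact star_apply_rotate hA i j
  rw [IsHermitian.gibbsWeight_eq hH, IsHermitian.gibbsWeight_eq hH, ← hU, ← hD₁, ← hD₂, hcyc,
    hD₁, hD₂, trace_mul_diagonal_mul_mul_diagonal]
  refine sum_congr rfl fun i _ => sum_congr rfl fun j _ => ?_
  rw [← hsr i j]
  have : A' i j * (Real.exp (-(s * β * hH.eigenvalues j)) : ℂ) * star (A' i j) *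
      (Real.exp (-((1 - s) * β * hH.eigenvalues i)) : ℂ) =
      (A' i j * star (A' i j)) * ((Real.exp (-(s * β * hH.eigenvalues j)) : ℂ) *
        (Real.exp (-((1 - s) * β * hH.eigenvalues i)) : ℂ)) := by ring
  rw [this, mul_star_eq_normSq_cast, ← Complex.ofReal_mul, ← Complex.ofReal_mul, ← Real.exp_add]
  congr 3
  ring

/-- **Spectral form of the double commutator**:
`tr(e^{-βH} [A,[H,A]]) = Σᵢⱼ ‖A'ᵢⱼ‖² (Eⱼ - Eᵢ)(e^{-βEᵢ} - e^{-βEⱼ})` for Hermitian `A`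
(`[A,[H,A]] = 2AHA - A²H - HA²`, symmetrised in `i ↔ j`). [cite: DLS1978, eq. (35)] -/
theorem IsHermitian.trace_gibbsWeight_mul_doubleComm {A : Matrix n n ℂ} (hA : A.IsHermitian)
    (β : ℝ) :
    (gibbsWeight β H * (A * (H * A - A * H) - (H * A - A * H) * A)).trace =
      ∑ i, ∑ j, ((‖(star (hH.eigenvectorUnitary : Matrix n n ℂ) * A *
          (hH.eigenvectorUnitary : Matrix n n ℂ)) i j‖ ^ 2 *
            ((hH.eigenvalues j - hH.eigenvalues i) *
              (Real.exp (-(β * hH.eigenvalues i)) - Real.exp (-(β * hH.eigenvalues j)))) : ℝ) :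
                ℂ) := by
  set U := (hH.eigenvectorUnitary : Matrix n n ℂ) with hU
  have hUm : U ∈ unitary (Matrix n n ℂ) := hH.eigenvectorUnitary.prop
  set A' := star U * A * U with hA'
  set E := hH.eigenvalues with hE
  set D : Matrix n n ℂ := diagonal (fun i => (E i : ℂ)) with hD
  have hHD : star U * H * U = D := hH.star_mul_self_mul_eq_diagonal
  -- rotate into the eigenbasis
  have hm : ∀ X Y : Matrix n n ℂ, star U * (X * Y) * U = star U * X * U * (star U * Y * U) :=
    star_unitary_mul_mul_mul hUm
  have hs : ∀ X Y : Matrix n n ℂ, star U * (X - Y) * U = star U * X * U - star U * Y * U := by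
    intro X Y; rw [Matrix.mul_sub, Matrix.sub_mul]
  have hrot : star U * (A * (H * A - A * H) - (H * A - A * H) * A) * U =
      A' * (D * A' - A' * D) - (D * A' - A' * D) * A' := by
    rw [hs, hm, hm, hs, hm, hm, hHD, ← hA']
  rw [IsHermitian.gibbsWeight_eq hH β, ← hU, trace_unitary_conj_mul, hrot]
  set W : n → ℂ := fun i => (Real.exp (-(β * E i)) : ℂ) with hW
  -- expand
  have hexp : diagonal W * (A' * (D * A' - A' * D) - (D * A' - A' * D) * A') =
      diagonal W * A' * (D * A') + diagonal W * A' * (D * A') - diagonal W * A' * (A' * D) -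
        diagonal W * (D * A') * A' := by
    simp only [Matrix.mul_sub, Matrix.sub_mul, Matrix.mul_assoc]
    abel
  rw [hexp, trace_sub, trace_sub, trace_add, trace_diagonal_mul_mul, trace_diagonal_mul_mul,
    trace_diagonal_mul_mul]
  have hDA : ∀ i j, (D * A') i j = (E i : ℂ) * A' i j := by
    intro i j; rw [hD, diagonal_mul]
  have hAD : ∀ i j, (A' * D) i j = A' i j * (E j : ℂ) := by
    intro i j; rw [hD, mul_diagonal]
  simp only [hDA, hAD]
  have hsr : ∀ i j, star (A' i j) = A' j i := fun i j => by
    rw [hA']; exact star_apply_rotate hA i j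
  have hn : ∀ i j, A' i j * A' j i = ((‖A' i j‖ ^ 2 : ℝ) : ℂ) := by
    intro i j; rw [← hsr i j, mul_star_eq_normSq_cast]
  have e1 : ∀ i j, W i * A' i j * ((E j : ℂ) * A' j i) = ((‖A' i j‖ ^ 2 : ℝ) : ℂ) * W i * E j := by
    intro i j; rw [← hn]; ring
  have e2 : ∀ i j, W i * A' i j * (A' j i * (E i : ℂ)) = ((‖A' i j‖ ^ 2 : ℝ) : ℂ) * W i * E i := by
    intro i j; rw [← hn]; ring
  have e3 : ∀ i j, W i * ((E i : ℂ) * A' i j) * A' j i = ((‖A' i j‖ ^ 2 : ℝ) : ℂ) * W i * E i := by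
    intro i j; rw [← hn]; ring
  simp only [e1, e2, e3]
  -- symmetrise: `Σᵢⱼ mᵢⱼ Wᵢ (Eⱼ - Eᵢ)` twice is `Σᵢⱼ mᵢⱼ (Eⱼ - Eᵢ)(Wᵢ - Wⱼ)`, using `mᵢⱼ = mⱼᵢ`
  have hmsymm : ∀ i j, ‖A' i j‖ = ‖A' j i‖ := by
    intro i j; rw [← hsr i j, norm_star]
  have hcomb : ∑ i, ∑ j, ((‖A' i j‖ ^ 2 : ℝ) : ℂ) * W i * (E j : ℂ) -
      ∑ i, ∑ j, ((‖A' i j‖ ^ 2 : ℝ) : ℂ) * W i * (E i : ℂ) =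
      ∑ i, ∑ j, ((‖A' i j‖ ^ 2 : ℝ) : ℂ) * W i * ((E j : ℂ) - E i) := by
    rw [← sum_sub_distrib]
    refine sum_congr rfl fun i _ => ?_
    rw [← sum_sub_distrib]
    refine sum_congr rfl fun j _ => ?_
    ring
  have hflip : ∑ i, ∑ j, ((‖A' i j‖ ^ 2 : ℝ) : ℂ) * W i * ((E j : ℂ) - E i) =
      ∑ i, ∑ j, ((‖A' i j‖ ^ 2 : ℝ) : ℂ) * W j * ((E i : ℂ) - E j) := by
    conv_rhs => rw [Finset.sum_comm]
    refine sum_congr rfl fun i _ => sum_congr rfl fun j _ => ?_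
    rw [hmsymm j i]
  have hLHS : ∑ i, ∑ j, ((‖A' i j‖ ^ 2 : ℝ) : ℂ) * W i * (E j : ℂ) +
      ∑ i, ∑ j, ((‖A' i j‖ ^ 2 : ℝ) : ℂ) * W i * (E j : ℂ) -
      ∑ i, ∑ j, ((‖A' i j‖ ^ 2 : ℝ) : ℂ) * W i * (E i : ℂ) -
      ∑ i, ∑ j, ((‖A' i j‖ ^ 2 : ℝ) : ℂ) * W i * (E i : ℂ) =
      (∑ i, ∑ j, ((‖A' i j‖ ^ 2 : ℝ) : ℂ) * W i * (E j : ℂ) -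
        ∑ i, ∑ j, ((‖A' i j‖ ^ 2 : ℝ) : ℂ) * W i * (E i : ℂ)) +
      (∑ i, ∑ j, ((‖A' i j‖ ^ 2 : ℝ) : ℂ) * W i * (E j : ℂ) -
        ∑ i, ∑ j, ((‖A' i j‖ ^ 2 : ℝ) : ℂ) * W i * (E i : ℂ)) := by ring
  rw [hLHS, hcomb]
  conv_lhs => arg 2; rw [hflip]
  rw [← sum_add_distrib]
  refine sum_congr rfl fun i _ => ?_
  rw [← sum_add_distrib]
  refine sum_congr rfl fun j _ => ?_
  rw [hW]
  push_cast
  ring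

/-! ### The three quantities `g = ⟨A²⟩`, `b = (A,A)`, `c = ⟨[A,[H,A]]⟩` as pair sums -/

omit [DecidableEq n] in
/-- The Duhamel kernel integrated against a weighted double sum. [folklore] -/
theorem integral_sum_sum_mul_exp (β : ℝ) (E : n → ℝ) (m : n → n → ℝ) :
    ∫ s in (0 : ℝ)..1, ∑ i, ∑ j, m i j * Real.exp (-(β * (s * E j + (1 - s) * E i))) =
      ∑ i, ∑ j, m i j * duhamelKernel β (E i) (E j) := by
  have hint : ∀ i j, IntervalIntegrable
      (fun s : ℝ => m i j * Real.exp (-(β * (s * E j + (1 - s) * E i)))) volume 0 1 := by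
    intro i j
    exact (Continuous.intervalIntegrable (by fun_prop) _ _)
  rw [intervalIntegral.integral_finsetSum (fun i _ =>
    Continuous.intervalIntegrable (by fun_prop) _ _)]
  refine sum_congr rfl fun i _ => ?_
  rw [intervalIntegral.integral_finsetSum (fun j _ => hint i j)]
  refine sum_congr rfl fun j _ => ?_
  rw [intervalIntegral.integral_const_mul, duhamelKernel]

/-- `Z = Σ e^{-βEᵢ}` as a real cast. [folklore] -/
theorem IsHermitian.partitionFn_eq_ofReal (β : ℝ) :
    partitionFn β H = ((∑ i, Real.exp (-(β * hH.eigenvalues i)) : ℝ) : ℂ) := by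
  rw [partitionFn_eq_sum_exp β hH]
  push_cast
  simp only [neg_mul]

/-- `Σ e^{-βEᵢ} > 0`. [folklore] -/
theorem IsHermitian.sum_exp_pos [Nonempty n] (β : ℝ) :
    0 < ∑ i, Real.exp (-(β * hH.eigenvalues i)) :=
  Finset.sum_pos (fun _ _ => Real.exp_pos _) Finset.univ_nonempty

/-- Real part of a Gibbs expectation: `Re ⟨X⟩ = Z⁻¹ Re tr(e^{-βH} X)`. [folklore] -/
theorem IsHermitian.re_gibbsState (β : ℝ) (X : Matrix n n ℂ) :
    (gibbsState β H X).re =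
      (∑ i, Real.exp (-(β * hH.eigenvalues i)))⁻¹ * (gibbsWeight β H * X).trace.re := by
  rw [gibbsState_apply, hH.partitionFn_eq_ofReal, ← Complex.ofReal_inv, Complex.re_ofReal_mul]

/-- Real part of a Duhamel function: `Re (A,B) = Z⁻¹ Re ∫ tr(⋯)`. [folklore] -/
theorem IsHermitian.re_duhamel (β : ℝ) (A B : Matrix n n ℂ) :
    (duhamel β H A B).re = (∑ i, Real.exp (-(β * hH.eigenvalues i)))⁻¹ *
      (∫ s in (0 : ℝ)..1,
        (A * gibbsWeight (s * β) H * B * gibbsWeight ((1 - s) * β) H).trace).re := by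
  rw [duhamel, hH.partitionFn_eq_ofReal, ← Complex.ofReal_inv, Complex.re_ofReal_mul]

/-- **Pair-sum form of `g = ⟨A²⟩`** ([DLS1978] (35): `g = Σ |aᵢⱼ|² (wᵢ + wⱼ)/2`).
[cite: DLS1978, eq. (35)] -/
theorem IsHermitian.re_gibbsState_sq {A : Matrix n n ℂ} (hA : A.IsHermitian) (β : ℝ) :
    (gibbsState β H (A * A)).re = (∑ i, Real.exp (-(β * hH.eigenvalues i)))⁻¹ *
      ∑ i, ∑ j, ‖(star (hH.eigenvectorUnitary : Matrix n n ℂ) * A *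
          (hH.eigenvectorUnitary : Matrix n n ℂ)) i j‖ ^ 2 * Real.exp (-(β * hH.eigenvalues i)) := by
  rw [hH.re_gibbsState, IsHermitian.trace_gibbsWeight_mul_sq hH hA]
  congr 1
  simp_rw [← Complex.ofReal_sum]
  rw [Complex.ofReal_re]

/-- **Pair-sum form of `b = (A,A)`** ([DLS1978] (35): `b = Σ |aᵢⱼ|² K(Eᵢ,Eⱼ)`).
[cite: DLS1978, eq. (35)] -/
theorem IsHermitian.re_duhamel_self {A : Matrix n n ℂ} (hA : A.IsHermitian) (β : ℝ) :
    (duhamel β H A A).re = (∑ i, Real.exp (-(β * hH.eigenvalues i)))⁻¹ *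
      ∑ i, ∑ j, ‖(star (hH.eigenvectorUnitary : Matrix n n ℂ) * A *
          (hH.eigenvectorUnitary : Matrix n n ℂ)) i j‖ ^ 2 *
            duhamelKernel β (hH.eigenvalues i) (hH.eigenvalues j) := by
  rw [hH.re_duhamel]
  congr 1
  simp_rw [IsHermitian.trace_duhamel_integrand hH hA, ← Complex.ofReal_sum]
  rw [intervalIntegral.integral_ofReal, Complex.ofReal_re, integral_sum_sum_mul_exp]

/-- **Pair-sum form of `c = ⟨[A,[H,A]]⟩`** ([DLS1978] (35): `c = Σ |aᵢⱼ|² (Eⱼ-Eᵢ)(wᵢ-wⱼ)`).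
[cite: DLS1978, eq. (35)] -/
theorem IsHermitian.re_gibbsState_doubleComm {A : Matrix n n ℂ} (hA : A.IsHermitian) (β : ℝ) :
    (gibbsState β H (A * (H * A - A * H) - (H * A - A * H) * A)).re =
      (∑ i, Real.exp (-(β * hH.eigenvalues i)))⁻¹ *
      ∑ i, ∑ j, ‖(star (hH.eigenvectorUnitary : Matrix n n ℂ) * A *
          (hH.eigenvectorUnitary : Matrix n n ℂ)) i j‖ ^ 2 *
            ((hH.eigenvalues j - hH.eigenvalues i) *
              (Real.exp (-(β * hH.eigenvalues i)) - Real.exp (-(β * hH.eigenvalues j)))) := by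
  rw [hH.re_gibbsState, IsHermitian.trace_gibbsWeight_mul_doubleComm hH hA]
  congr 1
  simp_rw [← Complex.ofReal_sum]
  rw [Complex.ofReal_re]

/-- `b = (A,A) ≥ 0` for Hermitian `A`. [cite: DLS1978, Thm. 3.1] -/
theorem IsHermitian.re_duhamel_self_nonneg (hH : H.IsHermitian) {A : Matrix n n ℂ}
    (hA : A.IsHermitian) (β : ℝ) : 0 ≤ (duhamel β H A A).re := by
  rw [hH.re_duhamel_self hA]
  exact mul_nonneg (inv_nonneg.2 (sum_nonneg fun i _ => (Real.exp_pos _).le))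
    (sum_nonneg fun i _ => sum_nonneg fun j _ => mul_nonneg (sq_nonneg _)
      (duhamelKernel_pos β _ _).le)

/-- `c = ⟨[A,[H,A]]⟩ ≥ 0` for Hermitian `A` and `β ≥ 0` ("can be seen from an
eigenfunction expansion of the trace", [LSSY2005] after (11.21)). [cite: DLS1978, Thm. 3.1]
[cite: LSSY2005, Ch. 11 (11.21)] -/
theorem IsHermitian.re_gibbsState_doubleComm_nonneg (hH : H.IsHermitian) {A : Matrix n n ℂ}
    (hA : A.IsHermitian) {β : ℝ} (hβ : 0 ≤ β) :
    0 ≤ (gibbsState β H (A * (H * A - A * H) - (H * A - A * H) * A)).re := by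
  rw [hH.re_gibbsState_doubleComm hA]
  exact mul_nonneg (inv_nonneg.2 (sum_nonneg fun i _ => (Real.exp_pos _).le))
    (sum_nonneg fun i _ => sum_nonneg fun j _ => mul_nonneg (sq_nonneg _)
      (sub_mul_exp_sub_exp_nonneg hβ _ _))

/-! ### The Falk–Bruch / Dyson–Lieb–Simon transfer (weak form) -/

/-- **Falk–Bruch inequality, weak form, for a finite family of Hermitian observables**
([DLS1978] Thm. 3.1 with Cor. 3.2 and Thm. 3.2, weakened by `coth x ≤ 1 + 1/x` as in
[LSSY2005] (11.22)–(11.23)): with `g = Σ_k ⟨A_k²⟩`, `b = Σ_k (A_k, A_k)` and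
`c = Σ_k ⟨[A_k,[H,A_k]]⟩`, one has `g ≤ b + ½ √(β b c)` (`β ≥ 0`). Proof: in an eigenbasis all
three are sums over pairs with the common weights `|a^k_{ij}|²`; per pair
`(wᵢ + wⱼ)/2 ≤ K + |wᵢ - wⱼ|/2` and `|wᵢ - wⱼ| = √(β K c_{ij})`; then Cauchy–Schwarz.
[cite: DLS1978, Thms. 3.1–3.2] [cite: LSSY2005, Ch. 11 (11.22)–(11.23)] -/
theorem falkBruch_sum_le (hH : H.IsHermitian) {β : ℝ} (hβ : 0 ≤ β) {ι : Type*} [Fintype ι]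
    {A : ι → Matrix n n ℂ} (hA : ∀ k, (A k).IsHermitian) :
    ∑ k, (gibbsState β H (A k * A k)).re ≤
      ∑ k, (duhamel β H (A k) (A k)).re +
        1 / 2 * Real.sqrt (β * (∑ k, (duhamel β H (A k) (A k)).re) *
          ∑ k, (gibbsState β H (A k * (H * A k - A k * H) - (H * A k - A k * H) * A k)).re) := by
  -- abbreviations
  set E := hH.eigenvalues with hE
  set W : n → ℝ := fun i => Real.exp (-(β * E i)) with hW
  set Zr : ℝ := ∑ i, W i with hZr
  set m : ι → n → n → ℝ := fun k i j => ‖(star (hH.eigenvectorUnitary : Matrix n n ℂ) * A k *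
    (hH.eigenvectorUnitary : Matrix n n ℂ)) i j‖ ^ 2 with hm
  set K : n → n → ℝ := fun i j => duhamelKernel β (E i) (E j) with hK
  set c : n → n → ℝ := fun i j => (E j - E i) * (W i - W j) with hc
  have hZr0 : 0 ≤ Zr := sum_nonneg fun i _ => (Real.exp_pos _).le
  have hm0 : ∀ k i j, 0 ≤ m k i j := fun k i j => sq_nonneg _
  have hK0 : ∀ i j, 0 ≤ K i j := fun i j => (duhamelKernel_pos β _ _).le
  have hc0 : ∀ i j, 0 ≤ c i j := fun i j => sub_mul_exp_sub_exp_nonneg hβ (E i) (E j)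
  have hmsymm : ∀ k i j, m k i j = m k j i := by
    intro k i j
    simp only [hm]
    rw [← star_apply_rotate (hA k) i j, norm_star]
  -- the three quantities as pair sums
  have hg : ∑ k, (gibbsState β H (A k * A k)).re = Zr⁻¹ * ∑ k, ∑ i, ∑ j, m k i j * W i := by
    rw [mul_sum]
    exact sum_congr rfl fun k _ => hH.re_gibbsState_sq (hA k) β
  have hb : ∑ k, (duhamel β H (A k) (A k)).re = Zr⁻¹ * ∑ k, ∑ i, ∑ j, m k i j * K i j := by
    rw [mul_sum]
    exact sum_congr rfl fun k _ => hH.re_duhamel_self (hA k) β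
  have hcc : ∑ k, (gibbsState β H (A k * (H * A k - A k * H) - (H * A k - A k * H) * A k)).re =
      Zr⁻¹ * ∑ k, ∑ i, ∑ j, m k i j * c i j := by
    rw [mul_sum]
    exact sum_congr rfl fun k _ => hH.re_gibbsState_doubleComm (hA k) β
  rw [hg, hb, hcc]
  -- unnormalised inequality
  set G : ℝ := ∑ k, ∑ i, ∑ j, m k i j * W i with hG
  set B : ℝ := ∑ k, ∑ i, ∑ j, m k i j * K i j with hB
  set C : ℝ := ∑ k, ∑ i, ∑ j, m k i j * c i j with hC
  have hB0 : 0 ≤ B := sum_nonneg fun k _ => sum_nonneg fun i _ => sum_nonneg fun j _ =>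
    mul_nonneg (hm0 k i j) (hK0 i j)
  -- symmetrised `G`
  have hGsymm : G = ∑ k, ∑ i, ∑ j, m k i j * ((W i + W j) / 2) := by
    have : ∀ k, ∑ i, ∑ j, m k i j * W i = ∑ i, ∑ j, m k i j * W j := by
      intro k
      rw [Finset.sum_comm]
      exact sum_congr rfl fun i _ => sum_congr rfl fun j _ => by rw [hmsymm k j i]
    rw [hG]
    refine sum_congr rfl fun k _ => ?_
    have h2 : ∑ i, ∑ j, m k i j * ((W i + W j) / 2) =
        (∑ i, ∑ j, m k i j * W i + ∑ i, ∑ j, m k i j * W j) / 2 := by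
      rw [← sum_add_distrib, Finset.sum_div]
      refine sum_congr rfl fun i _ => ?_
      rw [← sum_add_distrib, Finset.sum_div]
      refine sum_congr rfl fun j _ => ?_
      ring
    rw [h2, ← this]
    ring
  -- per-pair bound and Cauchy–Schwarz
  have hGle : G ≤ B + 1 / 2 * Real.sqrt (β * B * C) := by
    have hpair : ∀ k i j, m k i j * ((W i + W j) / 2) ≤
        m k i j * K i j +
          1 / 2 * (Real.sqrt (β * (m k i j * K i j)) * Real.sqrt (m k i j * c i j)) := by
      intro k i j
      have h1 := half_add_exp_le_duhamelKernel β (E i) (E j)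
      have h2 : Real.sqrt (β * (m k i j * K i j)) * Real.sqrt (m k i j * c i j) =
          m k i j * |W i - W j| := by
        rw [← Real.sqrt_mul (mul_nonneg hβ (mul_nonneg (hm0 k i j) (hK0 i j))),
          show β * (m k i j * K i j) * (m k i j * c i j) =
            (m k i j) ^ 2 * (β * K i j * c i j) by ring, hK, hc, hW, ← sq_exp_sub_exp_eq,
          ← mul_pow, Real.sqrt_sq_eq_abs, abs_mul, abs_of_nonneg (hm0 k i j)]
      rw [h2]
      have := mul_le_mul_of_nonneg_left h1 (hm0 k i j)
      simp only [hK, hW] at this ⊢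
      linarith
    calc G = ∑ k, ∑ i, ∑ j, m k i j * ((W i + W j) / 2) := hGsymm
      _ ≤ ∑ k, ∑ i, ∑ j, (m k i j * K i j +
          1 / 2 * (Real.sqrt (β * (m k i j * K i j)) * Real.sqrt (m k i j * c i j))) :=
          sum_le_sum fun k _ => sum_le_sum fun i _ => sum_le_sum fun j _ => hpair k i j
      _ = B + 1 / 2 * ∑ k, ∑ i, ∑ j,
          Real.sqrt (β * (m k i j * K i j)) * Real.sqrt (m k i j * c i j) := by
          rw [hB, mul_sum, ← sum_add_distrib]
          refine sum_congr rfl fun k _ => ?_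
          rw [mul_sum, ← sum_add_distrib]
          refine sum_congr rfl fun i _ => ?_
          rw [mul_sum, ← sum_add_distrib]
      _ ≤ B + 1 / 2 * (Real.sqrt (∑ k, ∑ i, ∑ j, β * (m k i j * K i j)) *
          Real.sqrt (∑ k, ∑ i, ∑ j, m k i j * c i j)) := by
          gcongr
          -- flatten to a sum over triples and apply Cauchy–Schwarz
          have hCS := Real.sum_sqrt_mul_sqrt_le (univ : Finset (ι × n × n))
            (f := fun p => β * (m p.1 p.2.1 p.2.2 * K p.2.1 p.2.2))
            (g := fun p => m p.1 p.2.1 p.2.2 * c p.2.1 p.2.2)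
            (fun p => mul_nonneg hβ (mul_nonneg (hm0 _ _ _) (hK0 _ _)))
            (fun p => mul_nonneg (hm0 _ _ _) (hc0 _ _))
          simpa only [Fintype.sum_prod_type] using hCS
      _ = B + 1 / 2 * Real.sqrt (β * B * C) := by
          have h1 : ∑ k, ∑ i, ∑ j, β * (m k i j * K i j) = β * B := by
            rw [hB, mul_sum]
            refine sum_congr rfl fun k _ => ?_
            rw [mul_sum]
            refine sum_congr rfl fun i _ => ?_
            rw [mul_sum]
          rw [h1, ← hC, ← Real.sqrt_mul (mul_nonneg hβ hB0)]
  -- normalise by `Z`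
  have hZinv : 0 ≤ Zr⁻¹ := inv_nonneg.2 hZr0
  have hsq : Real.sqrt (β * (Zr⁻¹ * B) * (Zr⁻¹ * C)) = Zr⁻¹ * Real.sqrt (β * B * C) := by
    rw [show β * (Zr⁻¹ * B) * (Zr⁻¹ * C) = (Zr⁻¹) ^ 2 * (β * B * C) by ring,
      Real.sqrt_mul (sq_nonneg _), Real.sqrt_sq hZinv]
  rw [hsq]
  calc Zr⁻¹ * G ≤ Zr⁻¹ * (B + 1 / 2 * Real.sqrt (β * B * C)) :=
        mul_le_mul_of_nonneg_left hGle hZinv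
    _ = _ := by ring

/-- **[DLS1978] Thm. 3.2, weak form**: an upper bound `b ≤ b₀` on the Duhamel functions is
transferred to the thermal expectations, `g ≤ b₀ + ½ √(β b₀ c)` (monotonicity of
`x ↦ x + ½√(β x c)`). This is the form consumed by infrared-bound arguments
([LSSY2005] (11.22)–(11.23): `⟨S̃¹S̃¹ + S̃²S̃²⟩ ≤ ½√(C_p/E_p) + 1/(βE_p)`).
[cite: DLS1978, Thm. 3.2] [cite: LSSY2005, Ch. 11 (11.22)–(11.23)] -/
theorem falkBruch_sum_le_of_le (hH : H.IsHermitian) {β : ℝ} (hβ : 0 ≤ β) {ι : Type*} [Fintype ι]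
    {A : ι → Matrix n n ℂ} (hA : ∀ k, (A k).IsHermitian) {b₀ : ℝ}
    (hb : ∑ k, (duhamel β H (A k) (A k)).re ≤ b₀) :
    ∑ k, (gibbsState β H (A k * A k)).re ≤
      b₀ + 1 / 2 * Real.sqrt (β * b₀ *
          ∑ k, (gibbsState β H (A k * (H * A k - A k * H) - (H * A k - A k * H) * A k)).re) := by
  have h := falkBruch_sum_le hH hβ hA
  have hc : 0 ≤ ∑ k, (gibbsState β H (A k * (H * A k - A k * H) - (H * A k - A k * H) * A k)).re :=
    sum_nonneg fun k _ => hH.re_gibbsState_doubleComm_nonneg (hA k) hβ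
  have hmono : Real.sqrt (β * (∑ k, (duhamel β H (A k) (A k)).re) *
      ∑ k, (gibbsState β H (A k * (H * A k - A k * H) - (H * A k - A k * H) * A k)).re) ≤
      Real.sqrt (β * b₀ *
        ∑ k, (gibbsState β H (A k * (H * A k - A k * H) - (H * A k - A k * H) * A k)).re) :=
    Real.sqrt_le_sqrt (mul_le_mul_of_nonneg_right (mul_le_mul_of_nonneg_left hb hβ) hc)
  linarith

end Spectral


/-! ### Entropy bookkeeping for Boltzmann weights -/

omit [DecidableEq n] in
/-- The Shannon entropy bound `-Σ pᵢ log pᵢ ≤ log N` for a probability vector with positive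
entries (`log x ≤ x - 1`). [folklore] -/
theorem neg_sum_mul_log_le [Nonempty n] {p : n → ℝ} (hp : ∀ i, 0 < p i) (hp1 : ∑ i, p i = 1) :
    -∑ i, p i * Real.log (p i) ≤ Real.log (Fintype.card n) := by
  have hN : (0 : ℝ) < Fintype.card n := by exact_mod_cast Fintype.card_pos
  have key : ∑ i, p i * Real.log (1 / (Fintype.card n * p i)) ≤ 0 := by
    calc ∑ i, p i * Real.log (1 / (Fintype.card n * p i))
        ≤ ∑ i, p i * (1 / (Fintype.card n * p i) - 1) :=
          sum_le_sum fun i _ => mul_le_mul_of_nonneg_left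
            (Real.log_le_sub_one_of_pos (by have := hp i; positivity)) (hp i).le
      _ = ∑ i, (1 / (Fintype.card n : ℝ) - p i) := by
          refine sum_congr rfl fun i _ => ?_
          have := (hp i).ne'
          field_simp
      _ = 0 := by
          rw [sum_sub_distrib, sum_const, card_univ, nsmul_eq_mul, hp1]
          field_simp; ring
  have hrw : ∀ i, p i * Real.log (1 / (Fintype.card n * p i)) =
      -(p i * Real.log (Fintype.card n)) - p i * Real.log (p i) := by
    intro i
    rw [one_div, Real.log_inv, Real.log_mul hN.ne' (hp i).ne']
    ring
  simp only [hrw, sum_sub_distrib, sum_neg_distrib, ← sum_mul, hp1, one_mul] at key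
  linarith

omit [DecidableEq n] in
/-- The Gibbs average of the energies is at most any level plus `log N / β`:
`Σ pᵢ xᵢ ≤ x_{i₀} + log N/β` for `pᵢ = e^{-βxᵢ}/Z` (`Z ≥ e^{-βx_{i₀}}` and the entropy bound).
[folklore] -/
theorem sum_boltzmann_mul_le {β : ℝ} (hβ : 0 < β) (x : n → ℝ) (i₀ : n) :
    (∑ i, Real.exp (-(β * x i)))⁻¹ * ∑ i, Real.exp (-(β * x i)) * x i ≤
      x i₀ + Real.log (Fintype.card n) / β := by
  haveI : Nonempty n := ⟨i₀⟩
  set Z : ℝ := ∑ i, Real.exp (-(β * x i)) with hZ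
  have hZpos : 0 < Z := sum_pos (fun i _ => Real.exp_pos _) univ_nonempty
  set p : n → ℝ := fun i => Z⁻¹ * Real.exp (-(β * x i)) with hp
  have hp0 : ∀ i, 0 < p i := fun i => mul_pos (inv_pos.2 hZpos) (Real.exp_pos _)
  have hp1 : ∑ i, p i = 1 := by
    rw [hp]; simp only; rw [← mul_sum, ← hZ, inv_mul_cancel₀ hZpos.ne']
  have hx : ∀ i, x i = -(Real.log (p i) + Real.log Z) / β := by
    intro i
    rw [hp]; dsimp only
    rw [Real.log_mul (inv_pos.2 hZpos).ne' (Real.exp_pos _).ne', Real.log_inv, Real.log_exp]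
    field_simp
    ring
  have hZge : -(β * x i₀) ≤ Real.log Z := by
    rw [← Real.log_exp (-(β * x i₀))]
    refine Real.log_le_log (Real.exp_pos _) ?_
    rw [hZ]
    exact single_le_sum (f := fun i => Real.exp (-(β * x i))) (fun i _ => (Real.exp_pos _).le)
      (mem_univ i₀)
  have hent := neg_sum_mul_log_le hp0 hp1
  have hlhs : Z⁻¹ * ∑ i, Real.exp (-(β * x i)) * x i = ∑ i, p i * x i := by
    rw [mul_sum]; refine sum_congr rfl fun i _ => ?_; rw [hp]; ring
  rw [hlhs]
  have hsum : ∑ i, p i * x i = -(∑ i, p i * Real.log (p i) + Real.log Z) / β := by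
    have : ∀ i, p i * x i = (-(p i * Real.log (p i)) - p i * Real.log Z) / β := by
      intro i; rw [hx i]; ring
    simp only [this, ← sum_div, sum_sub_distrib, sum_neg_distrib, ← sum_mul, hp1, one_mul]
    ring
  rw [hsum, div_le_iff₀ hβ, add_mul, div_mul_cancel₀ _ hβ.ne']
  linarith [hent, hZge]

/-! ### The Peierls–Bogoliubov inequality and the energy–entropy bound -/

section PeierlsBogoliubov

/-- **Peierls' inequality** `Σᵢ e^{Re Mᵢᵢ} ≤ Re tr e^{M}` for Hermitian `M` (Jensen for the
spectral measures of `M` in the basis states). [folklore] -/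
theorem IsHermitian.sum_exp_apply_le_trace_exp {M : Matrix n n ℂ} (hM : M.IsHermitian) :
    ∑ i, Real.exp ((M i i).re) ≤ (NormedSpace.exp M).trace.re := by
  set V := (hM.eigenvectorUnitary : Matrix n n ℂ) with hV
  have hVu : V ∈ unitary (Matrix n n ℂ) := hM.eigenvectorUnitary.prop
  rw [hM.exp_eq_conj_diagonal, ← hV, trace, Complex.re_sum]
  refine sum_le_sum fun i _ => ?_
  rw [diag_apply, conj_diagonal_apply_self, Complex.ofReal_re]
  have hMii : (M i i).re = ∑ k, ‖V i k‖ ^ 2 * hM.eigenvalues k := by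
    conv_lhs => rw [hM.eq_conj_diagonal, ← hV, conj_diagonal_apply_self, Complex.ofReal_re]
  rw [hMii]
  have hJ := (convexOn_exp).map_sum_le (t := (univ : Finset n)) (w := fun k => ‖V i k‖ ^ 2)
    (p := fun k => hM.eigenvalues k) (fun k _ => sq_nonneg _) (sum_norm_sq_row_eq_one hVu i)
    (fun k _ => Set.mem_univ _)
  simpa only [smul_eq_mul] using hJ

variable {H : Matrix n n ℂ}

/-- Unitary invariance of the partition function: `Z(UHU⋆) = Z(H)`. [folklore] -/
theorem partitionFn_unitary_conj {U : Matrix n n ℂ} (hU : U ∈ unitary (Matrix n n ℂ)) (β : ℝ)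
    (H : Matrix n n ℂ) : partitionFn β (U * H * star U) = partitionFn β H := by
  have hunit : IsUnit U := ⟨Unitary.toUnits ⟨U, hU⟩, rfl⟩
  have hinv : U⁻¹ = star U := by
    rw [Matrix.inv_eq_right_inv (Unitary.mul_star_self_of_mem hU)]
  rw [partitionFn, partitionFn, gibbsWeight, gibbsWeight, ← hinv, show -(β : ℂ) • (U * H * U⁻¹) =
    U * (-(β : ℂ) • H) * U⁻¹ by rw [Matrix.mul_smul, Matrix.smul_mul],
    Matrix.exp_conj _ _ hunit, trace_mul_cycle, hinv, Unitary.star_mul_self_of_mem hU,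
    Matrix.one_mul]

/-- **The Peierls–Bogoliubov inequality** `Z(H + W) ≥ Z(H) e^{-β ⟨W⟩_H}` for Hermitian `H`, `W`
(Peierls' inequality in an eigenbasis of `H`, then Jensen for the Boltzmann weights).
[folklore] -/
theorem peierls_bogoliubov (hH : H.IsHermitian) {W : Matrix n n ℂ} (hW : W.IsHermitian)
    (β : ℝ) :
    (partitionFn β H).re * Real.exp (-(β * (gibbsState β H W).re)) ≤
      (partitionFn β (H + W)).re := by
  classical
  rcases isEmpty_or_nonempty n with hn | hn
  · simp [partitionFn, trace]
  set U := (hH.eigenvectorUnitary : Matrix n n ℂ) with hU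
  have hUm : U ∈ unitary (Matrix n n ℂ) := hH.eigenvectorUnitary.prop
  set E := hH.eigenvalues with hE
  set W' := star U * W * U with hW'
  -- `Z(H+W) = Z(U⋆(H+W)U)` and `U⋆(H+W)U = diag(E) + W'`
  have hconj : star U * (H + W) * U = diagonal (fun i => (E i : ℂ)) + W' := by
    rw [Matrix.mul_add, Matrix.add_mul, hH.star_mul_self_mul_eq_diagonal, ← hE, ← hW']
  have hZ : partitionFn β (H + W) = partitionFn β (diagonal (fun i => (E i : ℂ)) + W') := by
    have h := partitionFn_unitary_conj (Unitary.star_mem hUm) β (H + W)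
    rw [star_star] at h
    rw [← h, hconj]
  -- Peierls for `M = -β (diag E + W')`
  have hM : (-(β : ℂ) • (diagonal (fun i => (E i : ℂ)) + W')).IsHermitian := by
    refine isHermitian_neg_smul β (IsHermitian.add ?_ ?_)
    · rw [IsHermitian, diagonal_conjTranspose]
      congr 1
      funext i
      simp
    · rw [hW', IsHermitian, conjTranspose_mul, conjTranspose_mul, hW.eq, star_eq_conjTranspose,
        conjTranspose_conjTranspose, Matrix.mul_assoc]
  have hP := hM.sum_exp_apply_le_trace_exp
  have hdiag : ∀ i, ((-(β : ℂ) • (diagonal (fun i => (E i : ℂ)) + W')) i i).re =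
      -(β * E i) + -(β * (W' i i).re) := by
    intro i
    simp [Matrix.smul_apply, Matrix.add_apply, diagonal_apply_eq, mul_add]
  have hP' : ∑ x, Real.exp (-(β * E x)) * Real.exp (-(β * (W' x x).re)) ≤
      (partitionFn β (diagonal (fun i => (E i : ℂ)) + W')).re := by
    simpa only [partitionFn, gibbsWeight, hdiag, Real.exp_add] using hP
  rw [hZ]
  refine le_trans ?_ hP'
  -- Jensen for the Boltzmann weights
  set w : n → ℝ := fun i => Real.exp (-(β * E i)) with hw
  set Zr : ℝ := ∑ i, w i with hZr
  have hZr : 0 < Zr := sum_pos (fun i _ => Real.exp_pos _) univ_nonempty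
  have hZre : (partitionFn β H).re = Zr := by
    rw [hH.partitionFn_eq_ofReal, Complex.ofReal_re]
  have hWexp : (gibbsState β H W).re = Zr⁻¹ * ∑ i, w i * (W' i i).re := by
    rw [hH.re_gibbsState, hH.gibbsWeight_eq β, ← hU, trace_unitary_conj_mul, ← hW', trace,
      Complex.re_sum]
    congr 1
    refine sum_congr rfl fun i _ => ?_
    rw [diag_apply, diagonal_mul, Complex.re_ofReal_mul]
  rw [hZre, hWexp]
  have hJ := (convexOn_exp).map_sum_le (t := (univ : Finset n)) (w := fun i => Zr⁻¹ * w i)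
    (p := fun i => -(β * (W' i i).re)) (fun i _ => by positivity)
    (by rw [← mul_sum, inv_mul_cancel₀ hZr.ne']) (fun i _ => Set.mem_univ _)
  simp only [smul_eq_mul] at hJ
  have hlhs : -(β * (Zr⁻¹ * ∑ i, w i * (W' i i).re)) = ∑ i, Zr⁻¹ * w i * -(β * (W' i i).re) := by
    rw [mul_sum, mul_sum, ← sum_neg_distrib]
    refine sum_congr rfl fun i _ => ?_
    ring
  rw [hlhs]
  calc Zr * Real.exp (∑ i, Zr⁻¹ * w i * -(β * (W' i i).re))
      ≤ Zr * ∑ i, Zr⁻¹ * w i * Real.exp (-(β * (W' i i).re)) :=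
        mul_le_mul_of_nonneg_left hJ hZr.le
    _ = ∑ i, w i * Real.exp (-(β * (W' i i).re)) := by
        rw [mul_sum]
        refine sum_congr rfl fun i _ => ?_
        field_simp
    _ = ∑ i, Real.exp (-(β * E i)) * Real.exp (-(β * (W' i i).re)) := rfl

/-- **Peierls–Bogoliubov for a unitary image**: if `UHU⋆ = H + W` then `⟨W⟩_H ≥ 0` (`β > 0`):
the partition functions agree, so `e^{-β⟨W⟩} ≤ 1`. This is the positive-temperature
replacement for the variational principle in Kubo-type inequalities. [folklore] -/
theorem re_gibbsState_nonneg_of_unitary_conj (hH : H.IsHermitian) [Nonempty n] {β : ℝ}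
    (hβ : 0 < β) {U : Matrix n n ℂ} (hU : U ∈ unitary (Matrix n n ℂ)) {W : Matrix n n ℂ}
    (hW : W.IsHermitian) (hUW : U * H * star U = H + W) :
    0 ≤ (gibbsState β H W).re := by
  have h := peierls_bogoliubov hH hW β
  rw [← hUW, partitionFn_unitary_conj hU] at h
  have hZ : 0 < (partitionFn β H).re := by
    rw [hH.partitionFn_eq_ofReal, Complex.ofReal_re]; exact hH.sum_exp_pos β
  have h1 : Real.exp (-(β * (gibbsState β H W).re)) ≤ 1 := by
    by_contra hcon
    push Not at hcon
    have := mul_lt_mul_of_pos_left hcon hZ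
    rw [mul_one] at this
    linarith
  rw [Real.exp_le_one_iff] at h1
  nlinarith

/-- **Energy–entropy bound**: `⟨H⟩_β ≤ Eᵢ + log(dim)/β` for every eigenvalue `Eᵢ` of `H`, `β > 0`
(Gibbs' variational principle: `⟨H⟩ - TS = F ≤ Eᵢ`, `S ≤ log dim`; proved through
`-Σ pⱼ log pⱼ ≤ log dim` for the Boltzmann weights). [folklore] -/
theorem re_gibbsState_hamiltonian_le (hH : H.IsHermitian) {β : ℝ} (hβ : 0 < β) (i₀ : n) :
    (gibbsState β H H).re ≤ hH.eigenvalues i₀ + Real.log (Fintype.card n) / β := by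
  haveI : Nonempty n := ⟨i₀⟩
  set U := (hH.eigenvectorUnitary : Matrix n n ℂ) with hU
  set E := hH.eigenvalues with hE
  have hexp : (gibbsState β H H).re =
      (∑ i, Real.exp (-(β * E i)))⁻¹ * ∑ i, Real.exp (-(β * E i)) * E i := by
    rw [hH.re_gibbsState, hH.gibbsWeight_eq β, ← hU, trace_unitary_conj_mul,
      hH.star_mul_self_mul_eq_diagonal, ← hE, trace, Complex.re_sum]
    congr 1
    refine sum_congr rfl fun i _ => ?_
    rw [diag_apply, diagonal_mul, diagonal_apply_eq, ← Complex.ofReal_mul, Complex.ofReal_re]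
  rw [hexp]
  exact sum_boltzmann_mul_le hβ E i₀

end PeierlsBogoliubov

/-! ### Named fact: Gaussian domination implies the Duhamel infrared bound -/

/-- **Gaussian domination ⇒ the infrared bound for the Duhamel two-point function**
([DLS1978] eq. (44), "Taking `hᵢ → λhᵢ` in (43), subtracting 1 from both sides, dividing by
`λ²`, and taking `λ` to zero"; [LSSY2005] after (11.12): "The infrared bound then follows from
`d²Z(εh)/dε²|_{ε=0} ≤ 0`"). Abstract form: if `H`, `V` are Hermitian, `β > 0`, `Q` real and
`Z_β(H - tV + ½t²Q) ≤ Z_β(H)` for all real `t`, then `(V, V)_{β,H} ≤ Q/β`. The proof is the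
second-order expansion of `t ↦ tr e^{-β(H - tV)}` at `t = 0`, whose second derivative is
`β² Z (V,V)` (Duhamel's formula); it is carried out in the sibling `DuhamelTwoPointProofs.lean`.
[cite: DLS1978, eq. (44)] [cite: LSSY2005, Ch. 11 (11.8)–(11.12)] -/
def gaussianDomination_duhamel_le : Prop :=
  ∀ (m : Type) [Fintype m] [DecidableEq m] [Nonempty m] (β : ℝ), 0 < β →
    ∀ (H V : Matrix m m ℂ), H.IsHermitian → V.IsHermitian → ∀ (Q : ℝ),
      (∀ t : ℝ, (partitionFn β (H - (t : ℂ) • V + ((t ^ 2 * Q / 2 : ℝ) : ℂ) • 1)).re ≤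
        (partitionFn β H).re) →
      (duhamel β H V V).re ≤ Q / β

end Matrix
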